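import Summits.CriticalPhenomena.Statement

/-!
# CriticalPhenomena / IsingEuclidUpgrade — assembly `(E) ∧ (U) → Ising3DConformalLimit`

Route `CriticalPhenomena/IsingEuclidUpgrade`, item `stmt-CriticalPhenomena-0633` (rank 1, assembly).
`(E)`: the critical Ising correlators on `ℤ³` have a non-degenerate, Euclidean-invariant,
scale-covariant pointwise scaling limit with `U₄ ≢ 0`; `(U)`: every such Euclidean-invariant
scale-covariant non-degenerate limit is inversion covariant with the same `Δ`. Since
`IsMoebiusCovariant Δ S` is by definition `IsEuclideanInvariant S ∧ IsScaleCovariant Δ S ∧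
IsInversionCovariant Δ S` (`Literature/Probability/LatticeModels/ConformalCovariance.lean`), the
implication is definitional glue (mirror of `Literature.Probability.LatticeModels.conformalLimit_implies_euclidean`).
-/

namespace CriticalPhenomena.IsingEuclidUpgrade

open Literature.Probability.LatticeModels Literature.Probability.Percolation

/-- Settles `stmt-CriticalPhenomena-0633` (exact signature): the route assembly
`(E) ∧ (U) → Ising3DConformalLimit`, by unfolding `IsMoebiusCovariant`
(Di Francesco–Mathieu–Sénéchal 1997, §4.3.1: Möbius = Euclidean + dilations + inversion). [folklore] -/
theorem conformalLimit_of_euclidean_and_inversionUpgrade :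
    ((∃ (ρ : ℝ → ℝ) (Δ : ℝ) (S : Literature.Probability.LatticeModels.CorrFamily 3), (∀ δ ∈ Set.Ioc (0:ℝ) 1, 0 < ρ δ) ∧
        0 < Δ ∧ Literature.Probability.LatticeModels.HasPointwiseScalingLimit (Literature.Probability.LatticeModels.criticalCorr 3) ρ S ∧
        Literature.Probability.LatticeModels.IsNondegenerateTwoPoint S ∧ Literature.Probability.LatticeModels.IsEuclideanInvariant S ∧
        Literature.Probability.LatticeModels.IsScaleCovariant Δ S ∧ Literature.Probability.LatticeModels.HasNontrivialU4 S) ∧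
      (∀ (ρ : ℝ → ℝ) (Δ : ℝ) (S : Literature.Probability.LatticeModels.CorrFamily 3), (∀ δ ∈ Set.Ioc (0:ℝ) 1, 0 < ρ δ) →
        Literature.Probability.LatticeModels.HasPointwiseScalingLimit (Literature.Probability.LatticeModels.criticalCorr 3) ρ S →
        Literature.Probability.LatticeModels.IsNondegenerateTwoPoint S → Literature.Probability.LatticeModels.IsEuclideanInvariant S →
        Literature.Probability.LatticeModels.IsScaleCovariant Δ S → Literature.Probability.LatticeModels.IsInversionCovariant Δ S)) →
      Ising3DConformalLimit := by
  rintro ⟨⟨ρ, Δ, S, hρ, hΔ, hlim, hnd, hE, hS, hU4⟩, hU⟩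
  exact ⟨ρ, Δ, S, hρ, hΔ, hlim, hnd, ⟨hE, hS, hU ρ Δ S hρ hlim hnd hE hS⟩, hU4⟩

/-- Converse bookkeeping: the conjunct gives back `(E)` (drop inversion covariance).
[folklore] -/
theorem euclideanU4_of_conformalLimit (h : Ising3DConformalLimit) :
    ∃ (ρ : ℝ → ℝ) (Δ : ℝ) (S : Literature.Probability.LatticeModels.CorrFamily 3), (∀ δ ∈ Set.Ioc (0:ℝ) 1, 0 < ρ δ) ∧
      0 < Δ ∧ Literature.Probability.LatticeModels.HasPointwiseScalingLimit (Literature.Probability.LatticeModels.criticalCorr 3) ρ S ∧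
      Literature.Probability.LatticeModels.IsNondegenerateTwoPoint S ∧ Literature.Probability.LatticeModels.IsEuclideanInvariant S ∧
      Literature.Probability.LatticeModels.IsScaleCovariant Δ S ∧ Literature.Probability.LatticeModels.HasNontrivialU4 S := by
  obtain ⟨ρ, Δ, S, hρ, hΔ, hlim, hnd, hM, hU4⟩ := h
  exact ⟨ρ, Δ, S, hρ, hΔ, hlim, hnd, hM.1, hM.2.1, hU4⟩

end CriticalPhenomena.IsingEuclidUpgrade
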